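import Mathlib
import HarnessLib
import Summits.HubbardSuperconductivity.HubbardSuperconductivity.Theorems.KLProgrammeKLRegimeAlphaWtFlow

/-!
# K3 ENGINE child (stmt-HubbardSuperconductivity-20437), stub (b): **`α_w` AT THE FLOW FRAME, DEEP WINDOW** — the `klScaleWt`-weighted
# `hrow/hcol` of `EngineV8.klNormsStepWt_of_sliceConsts` (`S(F̃_nf)ᵀ·klSliceCov (nf+j)·S(F̃_nf)` at `K_n`, weight scale `nw ≥ nf + j`) under the
# binders of `E4FlowAt` / `stub_engine_step_norms` on the U-DEPENDENT window `4^{n+2}·U ≤ 4^{2·nf+d}` — STILL one constant per `(j, d)`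

Cell `gate-hubbard-kl`, seat p3 (g11); program «DEEP-WINDOW TWINS» (KL STATUS 2026-08-27 23:19Z).  p582150 `alphaWt_klSliceCov_bgmFat_klEng_flow (j d)`
(p3 g10, `…AlphaWtFlow`) discharges the order-three frame datum of `alphaWt_klSliceCov_bgmFat_of_thresholds` on the INTEGER window
`n + 2 ≤ 2·nf + d` through `Gfr₃·U² ≤ 1`.  The same history data — `‖D³(frameShift K_n)‖ ≤ Gfr₃U²4ⁿ/3` (`frameShift_high_sizes_of_frameOK` on
`frameOK_klFlowFrameU_succ`) and `‖D³e_{K_n}‖ ≤ 64 + Gfr₃U²·Σ_{m<n}4^m` (`norm_iteratedFDeriv_frameLevel_klFlowFrameU_le`) — give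
`A₃Λ_{nf−1}² ≤ 4^d/3072` and `K₃Λ_{nf+j}² ≤ 1/16 + 4^d/3072` on the deeper, U-dependent window **`4^{n+2}·U ≤ 4^{2·nf+d}`** (depth
`n − 2·nf ≤ d − 2 + log₄U⁻¹`) through `Gfr₃·U ≤ 1` alone (the same door `U ≤ 1/(Gfr₃+1)`): the factor `U²` of the (I-F jets) is split as `(Gfr₃U)·(U·4ⁿ)`.
This is the DEEPEST window on which the plain derivative route keys `α_w` with an `R`-free, `U`-free constant; one step deeper
(`4^{n−2·nf} ≍ U⁻²`) the datum `a₃ ≍ Gfr₃·U²·4^{n−2·nf}` is `O(Gfr₃)` (finding «W2-HALF» / «(b)-Wt-FAMILY-DEEP»; cure (F1), k3c3-p2).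

* **`alphaWt_klSliceCov_bgmFat_klEng_flow_deep (j d)`** — `∃ Cα > 0`: for every `G P R Q cc` (`R.WF2`, `0 < cc ≤ klEngC₃6 P R`), `μ ∈ klWindowC`,
  `0 < U ≤ min (klEngU₀3 P R cc) (1/(Gfr₃+1))`, `klBetaMin ≤ β ≤ e^{cc/U²}`, `klEngL₃ β U ≤ L`, `klEngM₃ β U L ≤ M`, `1 ≤ n ≤ n_β + 1`,
  `HistP klPredsV17F2 … 0 n`, `FrameOK R U n_β μ K_n`, every `1 ≤ nf` with `nf + j ≤ n_β + 1`, `4^{n+2}·U ≤ 4^{2·nf+d}`, `nf + j ≤ nw`: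
  the weighted row and column sums are `≤ Cα·(M/β)/klScale klE0 (nf+j)` (same binder list as p582150 with the window replaced);
* `pow_window_of_nat_window` — the integer window implies the deep one (`U ≤ 1`), so this file supersedes p582150 pointwise;
* **`alphaWt_klSliceCov_bgmFat_klEng_flow_deep_at (j d)`** — the same bound at ANY EARLIER flow frame `K_m`, `1 ≤ m ≤ n`, from the CURRENT history
  `HistP … 0 n` alone (history restriction + `frameOK_klFlowFrameU_succ` + `FrameOK.mono`; no separate `FrameOK` binder): the BASE term of a frame
  telescope `K_{m₀} → K_n` ((F1), F1-DESIGN.md §1) in the engine's `R`-free currency, window `4^{m+2}·U ≤ 4^{2·nf+d}` at `m`.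

Everything is proved; no definitions. [cite: BenfattoGiulianiMastropietro2006, §2.8 (2.81), §3 (3.3)]
-/

noncomputable section

namespace Summit.HubbardSuperconductivity.HubbardSuperconductivity.Theorems.TorusFourierL2

set_option linter.dupNamespace false -- summit = problem name (single-conjunct summit), D-0017

open Set Finset Literature.MathematicalPhysics.QuantumLattice Literature.MathematicalPhysics.QuantumLattice.BandSectorCounting
open Literature.MathematicalPhysics.QuantumLattice.FermiRG Literature.Probability.LatticeModels Literature.Analysis.SpecialFunctions
open Summit.HubbardSuperconductivity.HubbardSuperconductivity.Theorems.DispersionFlow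
open Summit.HubbardSuperconductivity.HubbardSuperconductivity.Theorems.KLRegimeSplit
open Summit.HubbardSuperconductivity.HubbardSuperconductivity.Theorems.KLProgrammeLegKernels
open Summit.HubbardSuperconductivity.HubbardSuperconductivity.Theorems.PerturbedFermiCurve
open Summit.HubbardSuperconductivity.HubbardSuperconductivity.Theorems.KLRegimeWick
open Summit.HubbardSuperconductivity.HubbardSuperconductivity.Theorems.EngineV8
open scoped Real Nat

open Classical

/-- **The integer window implies the deep window**: `n + 2 ≤ 2·nf + d` and `0 ≤ U ≤ 1` give `4^{n+2}·U ≤ 4^{2·nf+d}`; so the deep-window door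
below contains p582150's integer-window door pointwise (`0 ≤ U` is not even needed). [folklore] -/
theorem pow_window_of_nat_window {U : ℝ} (hU1 : U ≤ 1) {n nf dd : ℕ} (h : n + 2 ≤ 2 * nf + dd) :
    (4 : ℝ) ^ (n + 2) * U ≤ (4 : ℝ) ^ (2 * nf + dd) :=
  calc (4 : ℝ) ^ (n + 2) * U ≤ (4 : ℝ) ^ (n + 2) * 1 := mul_le_mul_of_nonneg_left hU1 (by positivity)
    _ = (4 : ℝ) ^ (n + 2) := mul_one _
    _ ≤ (4 : ℝ) ^ (2 * nf + dd) := pow_le_pow_right₀ (by norm_num) h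

/-- **The deep window in logarithmic form**: `4^{n+2}·U ≤ 4^{2·nf+d}` holds as soon as `4^{n+2−2·nf−d} ≤ U⁻¹`, i.e. the depth `n − 2·nf`
is at most `d − 2 + log₄ U⁻¹` (stated multiplicatively: `4^{n+2} ≤ 4^{2·nf+d}·U⁻¹`). [folklore] -/
theorem pow_window_of_le_inv {U : ℝ} (hU : 0 < U) {n nf dd : ℕ} (h : (4 : ℝ) ^ (n + 2) ≤ (4 : ℝ) ^ (2 * nf + dd) * U⁻¹) :
    (4 : ℝ) ^ (n + 2) * U ≤ (4 : ℝ) ^ (2 * nf + dd) := by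
  have := mul_le_mul_of_nonneg_right h hU.le
  rwa [mul_assoc, inv_mul_cancel₀ hU.ne', mul_one] at this

/-- **The order-three frame datum on the deep window**: `Gfr₃·U ≤ 1`, `4^{N+3}·U ≤ 4^{2·nf+d}` and `1 ≤ nf` give
`Gfr₃U²·(4^{N+1}/3)·Λ_{nf−1}² ≤ 4^d/3072` (`Λ_m = klScale klE0 m = 4^{−m}/32`): the factor `U²` is split as `(Gfr₃U)·(U·4^{N+1})`.
[cite: BenfattoGiulianiMastropietro2006, §3 (3.3)] -/
theorem frameDatum_le_of_pow_window {G₃ U : ℝ} (hU : 0 ≤ U) (hGU : G₃ * U ≤ 1) {N nf dd : ℕ} (hnf : 1 ≤ nf)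
    (hwin : (4 : ℝ) ^ (N + 1 + 2) * U ≤ (4 : ℝ) ^ (2 * nf + dd)) :
    G₃ * U ^ 2 * ((4 : ℝ) ^ (N + 1) / 3) * klScale klE0 (nf - 1) ^ 2 ≤ (4 : ℝ) ^ dd / 3072 := by
  have hΛm : klScale klE0 (nf - 1) = (1 / 32) * ((4 : ℝ) ^ (nf - 1))⁻¹ := by rw [klScale, klE0]
  have h4 : (0 : ℝ) < (4 : ℝ) ^ (nf - 1) := by positivity
  -- `U·4^{N+1} ≤ 4^{dd}·(4^{nf−1})²`
  have hpow : U * (4 : ℝ) ^ (N + 1) ≤ (4 : ℝ) ^ dd * ((4 : ℝ) ^ (nf - 1)) ^ 2 := by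
    have e1 : (4 : ℝ) ^ (N + 1 + 2) * U = 16 * (U * (4 : ℝ) ^ (N + 1)) := by rw [pow_add]; ring
    have e2 : (4 : ℝ) ^ (2 * nf + dd) = 16 * ((4 : ℝ) ^ dd * ((4 : ℝ) ^ (nf - 1)) ^ 2) := by
      obtain ⟨k, rfl⟩ : ∃ k, nf = k + 1 := ⟨nf - 1, by omega⟩
      rw [show k + 1 - 1 = k from rfl, show 2 * (k + 1) + dd = dd + k * 2 + 2 by ring, pow_add, pow_add, pow_mul]
      ring
    rw [e1, e2] at hwin
    exact le_of_mul_le_mul_left hwin (by norm_num)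
  rw [hΛm]
  have e : G₃ * U ^ 2 * ((4 : ℝ) ^ (N + 1) / 3) * ((1 / 32) * ((4 : ℝ) ^ (nf - 1))⁻¹) ^ 2 =
      (G₃ * U) * ((U * (4 : ℝ) ^ (N + 1)) / ((4 : ℝ) ^ (nf - 1)) ^ 2) / 3072 := by
    field_simp
    ring
  rw [e]
  have h2 : (U * (4 : ℝ) ^ (N + 1)) / ((4 : ℝ) ^ (nf - 1)) ^ 2 ≤ (4 : ℝ) ^ dd := by
    rw [div_le_iff₀ (by positivity)]; exact hpow
  have h3 : (G₃ * U) * ((U * (4 : ℝ) ^ (N + 1)) / ((4 : ℝ) ^ (nf - 1)) ^ 2) ≤ 1 * (4 : ℝ) ^ dd :=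
    mul_le_mul hGU h2 (by positivity) zero_le_one
  linarith only [h3]

set_option maxHeartbeats 1600000 in -- long regime bookkeeping
/-- **`α_w` at the flow frame, in the KL regime, DEEP WINDOW `4^{n+2}·U ≤ 4^{2·nf+d}`** (see the module docstring): p582150 verbatim with the
integer window replaced by the U-dependent one; one constant per `(j, d)`, `R`-free, `U`-free. [cite: BenfattoGiulianiMastropietro2006, §2.8 (2.81), §3 (3.3)] -/
theorem alphaWt_klSliceCov_bgmFat_klEng_flow_deep (j dd : ℕ) :
    ∃ Cα : ℝ, 0 < Cα ∧
      ∀ (G : GeoConsts) (P : SplitConsts) (R : RenConsts) (Q : EngConsts) (cc : ℝ), R.WF2 → 0 < cc → cc ≤ EngineV8.klEngC₃6 P R →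
      ∀ μ ∈ klWindowC, ∀ U : ℝ, 0 < U → U ≤ min (EngineV8.klEngU₀3 P R cc) (1 / (R.Gfr 3 + 1)) →
      ∀ β : ℝ, klBetaMin ≤ β → β ≤ Real.exp (cc / U ^ 2) →
      ∀ (L M : ℕ) [NeZero L] [NeZero M], EngineV8.klEngL₃ β U ≤ L → EngineV8.klEngM₃ β U L ≤ M →
      ∀ n : ℕ, 1 ≤ n → n ≤ nScales β + 1 →
        HistP klPredsV17F2 L M G P Q R β U μ 0 n → FrameOK R U (nScales β) μ (klFlowFrameU L M β U μ n) →
        ∀ nf : ℕ, 1 ≤ nf → nf + j ≤ nScales β + 1 → (4 : ℝ) ^ (n + 2) * U ≤ (4 : ℝ) ^ (2 * nf + dd) → ∀ nw : ℕ, nf + j ≤ nw →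
        (∀ Y : SpaceTimeIdx L M × SectorLeg (sectorCount nf),
          ∑ Y', ‖((sectorSubMatrix L M β (bgmFatMultiplier L M klE0 β (nambuXiCT L μ (klFlowFrameU L M β U μ n)) nf)).transpose *
            klSliceCov L M β μ (klFlowFrameU L M β U μ n) (nf + j) *
            sectorSubMatrix L M β (bgmFatMultiplier L M klE0 β (nambuXiCT L μ (klFlowFrameU L M β U μ n)) nf)) Y Y'‖ *
              EngineV8.klScaleWt L M β nw {EngineV8.latticeLegPos (2 * (2 * M)) Y, EngineV8.latticeLegPos (2 * (2 * M)) Y'} ≤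
            Cα * ((M : ℝ) / β) / klScale klE0 (nf + j)) ∧
        (∀ Y' : SpaceTimeIdx L M × SectorLeg (sectorCount nf),
          ∑ Y, ‖((sectorSubMatrix L M β (bgmFatMultiplier L M klE0 β (nambuXiCT L μ (klFlowFrameU L M β U μ n)) nf)).transpose *
            klSliceCov L M β μ (klFlowFrameU L M β U μ n) (nf + j) *
            sectorSubMatrix L M β (bgmFatMultiplier L M klE0 β (nambuXiCT L μ (klFlowFrameU L M β U μ n)) nf)) Y Y'‖ *
              EngineV8.klScaleWt L M β nw {EngineV8.latticeLegPos (2 * (2 * M)) Y, EngineV8.latticeLegPos (2 * (2 * M)) Y'} ≤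
            Cα * ((M : ℝ) / β) / klScale klE0 (nf + j)) := by
  have ha : (-4 : ℝ) < -(6 / 5) := by norm_num
  have hab : (-(6 / 5) : ℝ) ≤ -(1 / 10) := by norm_num
  have hb : (-(1 / 10) : ℝ) < 0 := by norm_num
  obtain ⟨Cα, hCα, h⟩ := alphaWt_klSliceCov_bgmFat_of_thresholds ha hab hb j ((4 : ℝ) ^ dd / 3072) (1 / 16 + (4 : ℝ) ^ dd / 3072)
  refine ⟨Cα, hCα, ?_⟩
  intro G P R Q cc hR2 hcc hcc6 μ hμ U hU hUle β hβmin hβc L M _ _ hL3 hM3 n hn1 hnN hhist hfr nf hnf hnfN hwin nw hnw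
  have hRj : ∀ i, 0 ≤ R.Gfr i := EngineV8.gfr_nonneg_of_wf2 hR2
  have hcle := (hcc6.trans (EngineV8.klEngC₃6_le_klEngC₃3 P R)).trans (EngineV8.klEngC₃3_le_symbolC₃ ha hab hb P hRj)
  have hU3 := (hUle.trans (min_le_left _ _)).trans (EngineV8.klEngU₀3_le_symbolU₀ ha hab hb P hRj cc)
  have hUG : U ≤ 1 / (R.Gfr 3 + 1) := hUle.trans (min_le_right _ _)
  have hLβ : β ^ 2 ≤ (L : ℝ) := EngineV8.sq_le_of_klEngL₃_le hL3
  have hMβ : β ≤ (M : ℝ) := EngineV8.le_of_klEngM₃_le hβmin hL3 hM3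
  set K : TrigPolyC4v := klFlowFrameU L M β U μ n with hKdef
  -- the order-three data of the flow frame from the history's (I-F jets)
  obtain ⟨N, rfl⟩ : ∃ N, n = N + 1 := ⟨n - 1, by omega⟩
  have hh := (histP_klPredsV17F2_iff L M G P Q R β U μ 0 (N + 1)).1 hhist
  have hJets : ∀ m ≤ N, FlowPieceJetsAt L M β U μ R m := fun m hm => (hh m (Nat.lt_succ_of_le hm)).2.1.2.1
  have hJets' : ∀ m < N + 1, FlowPieceJetsAt L M β U μ R m := fun m hm => hJets m (Nat.le_of_lt_succ hm)
  have hGeo : FlowGeometryAt L M β U μ N := (hh N (Nat.lt_succ_self N)).2.1.2.2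
  have hK1 : FrameOK R U N μ K := frameOK_klFlowFrameU_succ hJets hGeo
  have hA3 : ∀ p : Momentum, ‖iteratedFDeriv ℝ 3 (frameShift K) p‖ ≤ R.Gfr 3 * U ^ 2 * ((4 : ℝ) ^ (N + 1) / 3) :=
    (frameShift_high_sizes_of_frameOK hRj hK1).1
  -- the door `U ≤ 1/(Gfr₃+1)` gives `Gfr₃·U ≤ 1` (the deep window needs only this, not `Gfr₃·U² ≤ 1`)
  have hGU : R.Gfr 3 * U ≤ 1 := by
    have hG3 := hRj 3
    calc R.Gfr 3 * U ≤ R.Gfr 3 * (1 / (R.Gfr 3 + 1)) := mul_le_mul_of_nonneg_left hUG hG3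
      _ = R.Gfr 3 / (R.Gfr 3 + 1) := by ring
      _ ≤ 1 := by rw [div_le_one (by positivity)]; linarith only [hG3]
  -- the geometric sum of the band third-derivative bound
  have hsum : ∑ m' ∈ range (N + 1), R.Gfr 3 * uPow 3 U * (4 : ℝ) ^ ((((3 : ℕ) : ℤ) - 2) * m') ≤ R.Gfr 3 * U ^ 2 * ((4 : ℝ) ^ (N + 1) / 3) := by
    have e3 : uPow 3 U = U ^ 2 := by rw [show (3 : ℕ) = 2 + 1 by rfl, uPow_succ]
    have hterm : ∀ m' : ℕ, (4 : ℝ) ^ ((((3 : ℕ) : ℤ) - 2) * (m' : ℤ)) = (4 : ℝ) ^ m' := by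
      intro m'
      rw [show (((3 : ℕ) : ℤ) - 2) * (m' : ℤ) = ((m' : ℕ) : ℤ) by push_cast; ring, zpow_natCast]
    have hgeom : ∀ k : ℕ, ∑ m' ∈ range k, (4 : ℝ) ^ m' ≤ (4 : ℝ) ^ k / 3 := by
      intro k
      induction k with
      | zero => simp
      | succ k ih => rw [Finset.sum_range_succ, pow_succ]; linarith
    calc ∑ m' ∈ range (N + 1), R.Gfr 3 * uPow 3 U * (4 : ℝ) ^ ((((3 : ℕ) : ℤ) - 2) * m')
        = R.Gfr 3 * U ^ 2 * ∑ m' ∈ range (N + 1), (4 : ℝ) ^ m' := by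
          rw [Finset.mul_sum]; exact Finset.sum_congr rfl fun m' _ => by rw [e3, hterm]
      _ ≤ R.Gfr 3 * U ^ 2 * ((4 : ℝ) ^ (N + 1) / 3) := mul_le_mul_of_nonneg_left (hgeom (N + 1)) (by have := hRj 3; positivity)
  have hK3 : ∀ p : Momentum, ‖iteratedFDeriv ℝ 3 (frameLevel μ K) p‖ ≤ 64 + R.Gfr 3 * U ^ 2 * ((4 : ℝ) ^ (N + 1) / 3) := by
    intro p
    have h0 := norm_iteratedFDeriv_frameLevel_klFlowFrameU_le (L := L) (M := M) (β := β) (U := U) (μ := μ) (i := 3) (by norm_num) (by norm_num)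
      hJets' p
    have e64 : (4 : ℝ) ^ (3 : ℕ) = 64 := by norm_num
    rw [e64] at h0
    exact h0.trans (by linarith only [hsum])
  -- the data on the DEEP window `4^{n+2}·U ≤ 4^{2·nf+dd}`
  have hdatA : R.Gfr 3 * U ^ 2 * ((4 : ℝ) ^ (N + 1) / 3) * klScale klE0 (nf - 1) ^ 2 ≤ (4 : ℝ) ^ dd / 3072 :=
    frameDatum_le_of_pow_window hU.le hGU hnf hwin
  have hdatK : (64 + R.Gfr 3 * U ^ 2 * ((4 : ℝ) ^ (N + 1) / 3)) * klScale klE0 (nf + j) ^ 2 ≤ 1 / 16 + (4 : ℝ) ^ dd / 3072 := by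
    have hΛle : klScale klE0 (nf + j) ≤ klScale klE0 (nf - 1) := EngineV8.klScale_le_klScale (by norm_num [klE0]) (by omega)
    have hΛe : klScale klE0 (nf + j) ≤ 1 / 32 := by
      have := klScale_le_e0 (show (0 : ℝ) ≤ klE0 by norm_num [klE0]) (nf + j); rwa [show klE0 = 1 / 32 from rfl] at this
    have hΛ0 : 0 ≤ klScale klE0 (nf + j) := (klth_klScale_pos _).le
    have h1 : 64 * klScale klE0 (nf + j) ^ 2 ≤ 1 / 16 := by nlinarith [hΛe, hΛ0]
    have h2 : R.Gfr 3 * U ^ 2 * ((4 : ℝ) ^ (N + 1) / 3) * klScale klE0 (nf + j) ^ 2 ≤ (4 : ℝ) ^ dd / 3072 := by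
      refine le_trans ?_ hdatA
      have h0 : 0 ≤ R.Gfr 3 * U ^ 2 * ((4 : ℝ) ^ (N + 1) / 3) := by have := hRj 3; positivity
      exact mul_le_mul_of_nonneg_left (pow_le_pow_left₀ hΛ0 hΛle 2) h0
    nlinarith only [h1, h2]
  exact h R hRj cc U hcc hcle hU hU3 β hβmin hβc μ hμ K hfr _ _ hA3 hK3 L M hLβ hMβ nf hnf hnfN hdatA hdatK nw hnw

/-- **The flow frame `K_m` is admissible at full depth from the CURRENT history** (`1 ≤ m ≤ n`, `m ≤ n_β + 1`): (I-F jets) at every `m' < m` and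
(I-F geometry) at `m − 1` are renormalisation slots of `HistP … 0 n`; `frameOK_klFlowFrameU_succ` then `FrameOK.mono` from depth `m − 1` to `n_β`.
(The `m = n` case is the stub's own `FrameOK` binder; stated here so that a telescope base at `K_{m₀}` needs no extra hypothesis.) -/
theorem frameOK_klFlowFrameU_of_histP_le {L M : ℕ} [NeZero L] [NeZero M] {G : GeoConsts} {P : SplitConsts} {Q : EngConsts} {R : RenConsts}
    {β U μ : ℝ} (hR2 : R.WF2) {n m : ℕ} (hm1 : 1 ≤ m) (hmn : m ≤ n) (hmN : m ≤ nScales β + 1)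
    (hhist : HistP klPredsV17F2 L M G P Q R β U μ 0 n) : FrameOK R U (nScales β) μ (klFlowFrameU L M β U μ m) := by
  obtain ⟨N, rfl⟩ : ∃ N, m = N + 1 := ⟨m - 1, by omega⟩
  have hh := (histP_klPredsV17F2_iff L M G P Q R β U μ 0 n).1 hhist
  have hJ : ∀ m' ≤ N, FlowPieceJetsAt L M β U μ R m' := fun m' hm' => (hh m' (by omega)).2.1.2.1
  have hG : FlowGeometryAt L M β U μ N := (hh N (by omega)).2.1.2.2
  exact FrameOK.mono (EngineV8.gfr_nonneg_of_wf2 hR2) (by omega) (frameOK_klFlowFrameU_succ hJ hG)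

/-- **History restriction** (one line on `histP_klPredsV17F2_iff`): the V17F2 history up to `n` contains the history up to every `m ≤ n`. -/
theorem histP_klPredsV17F2_restrict {L M : ℕ} [NeZero L] [NeZero M] {G : GeoConsts} {P : SplitConsts} {Q : EngConsts} {R : RenConsts}
    {β U μ : ℝ} {K : TrigPolyC4v} {n m : ℕ} (hmn : m ≤ n) (hhist : HistP klPredsV17F2 L M G P Q R β U μ K n) :
    HistP klPredsV17F2 L M G P Q R β U μ K m :=
  (histP_klPredsV17F2_iff L M G P Q R β U μ K m).2 fun j hj => (histP_klPredsV17F2_iff L M G P Q R β U μ K n).1 hhist j (lt_of_lt_of_le hj hmn)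

/-- **`α_w` at ANY EARLIER flow frame `K_m` (`1 ≤ m ≤ n`) from the CURRENT history, deep window at `m`** — the base term of a frame telescope
`K_{m₀} → K_n` in the engine's currency: `alphaWt_klSliceCov_bgmFat_klEng_flow_deep` at `n := m` with its two frame inputs discharged by
`histP_klPredsV17F2_restrict` and `frameOK_klFlowFrameU_of_histP_le`.  Same constant `Cα(j, d)`. [cite: BenfattoGiulianiMastropietro2006, §2.8 (2.81), §3 (3.3)] -/
theorem alphaWt_klSliceCov_bgmFat_klEng_flow_deep_at (j dd : ℕ) :
    ∃ Cα : ℝ, 0 < Cα ∧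
      ∀ (G : GeoConsts) (P : SplitConsts) (R : RenConsts) (Q : EngConsts) (cc : ℝ), R.WF2 → 0 < cc → cc ≤ EngineV8.klEngC₃6 P R →
      ∀ μ ∈ klWindowC, ∀ U : ℝ, 0 < U → U ≤ min (EngineV8.klEngU₀3 P R cc) (1 / (R.Gfr 3 + 1)) →
      ∀ β : ℝ, klBetaMin ≤ β → β ≤ Real.exp (cc / U ^ 2) →
      ∀ (L M : ℕ) [NeZero L] [NeZero M], EngineV8.klEngL₃ β U ≤ L → EngineV8.klEngM₃ β U L ≤ M →
      ∀ n : ℕ, n ≤ nScales β + 1 → HistP klPredsV17F2 L M G P Q R β U μ 0 n →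
        ∀ m : ℕ, 1 ≤ m → m ≤ n →
        ∀ nf : ℕ, 1 ≤ nf → nf + j ≤ nScales β + 1 → (4 : ℝ) ^ (m + 2) * U ≤ (4 : ℝ) ^ (2 * nf + dd) → ∀ nw : ℕ, nf + j ≤ nw →
        (∀ Y : SpaceTimeIdx L M × SectorLeg (sectorCount nf),
          ∑ Y', ‖((sectorSubMatrix L M β (bgmFatMultiplier L M klE0 β (nambuXiCT L μ (klFlowFrameU L M β U μ m)) nf)).transpose *
            klSliceCov L M β μ (klFlowFrameU L M β U μ m) (nf + j) *
            sectorSubMatrix L M β (bgmFatMultiplier L M klE0 β (nambuXiCT L μ (klFlowFrameU L M β U μ m)) nf)) Y Y'‖ *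
              EngineV8.klScaleWt L M β nw {EngineV8.latticeLegPos (2 * (2 * M)) Y, EngineV8.latticeLegPos (2 * (2 * M)) Y'} ≤
            Cα * ((M : ℝ) / β) / klScale klE0 (nf + j)) ∧
        (∀ Y' : SpaceTimeIdx L M × SectorLeg (sectorCount nf),
          ∑ Y, ‖((sectorSubMatrix L M β (bgmFatMultiplier L M klE0 β (nambuXiCT L μ (klFlowFrameU L M β U μ m)) nf)).transpose *
            klSliceCov L M β μ (klFlowFrameU L M β U μ m) (nf + j) *
            sectorSubMatrix L M β (bgmFatMultiplier L M klE0 β (nambuXiCT L μ (klFlowFrameU L M β U μ m)) nf)) Y Y'‖ *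
              EngineV8.klScaleWt L M β nw {EngineV8.latticeLegPos (2 * (2 * M)) Y, EngineV8.latticeLegPos (2 * (2 * M)) Y'} ≤
            Cα * ((M : ℝ) / β) / klScale klE0 (nf + j)) := by
  obtain ⟨Cα, hCα, h⟩ := alphaWt_klSliceCov_bgmFat_klEng_flow_deep j dd
  refine ⟨Cα, hCα, ?_⟩
  intro G P R Q cc hR2 hcc hcc6 μ hμ U hU hUle β hβmin hβc L M _ _ hL3 hM3 n hnN hhist m hm1 hmn nf hnf hnfN hwin nw hnw
  exact h G P R Q cc hR2 hcc hcc6 μ hμ U hU hUle β hβmin hβc L M hL3 hM3 m hm1 (hmn.trans hnN) (histP_klPredsV17F2_restrict hmn hhist)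
    (frameOK_klFlowFrameU_of_histP_le hR2 hm1 hmn (hmn.trans hnN) hhist) nf hnf hnfN hwin nw hnw

end Summit.HubbardSuperconductivity.HubbardSuperconductivity.Theorems.TorusFourierL2

end
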